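import Summits.RiemannHypothesis.RiemannHypothesis.Theorems.SuzukiWindowsDoorArchLeadingTerm
import Summits.RiemannHypothesis.RiemannHypothesis.Theorems.SuzukiWindowsDoorExplicitOpNorm
import Summits.RiemannHypothesis.RiemannHypothesis.Theorems.SuzukiWindowFactorisation

/-!
# SuzukiWindowsDoorSmallWindowLawHS — the Hilbert–Schmidt small-window law `h_θ(t) = c_θ²(2t)^{2θ}/((2θ−1)2θ)·(1 + O(t))` (column DBR; RH-FREE)

LINE 1 — LABEL: RH-FREE asymptotics with explicit constants for ONE explicit kernel, Suzuki's `K_θ = limKernel θ`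
([Su20] = arXiv:1907.07302, (1.4)/(1.10)); bears_on: LADDER-RH B-D(b) → B-P(P2) (PROOF-OF-DATA for DATA.md §ET1 /
§ET1g: the weighted Hilbert–Schmidt quantity `h_θ(t) = ∫₀^{2t}(2t − u)K_θ(u)²du = ‖𝖪_θ[t]‖²_HS` whose certified values give
the column's first windows, `t_HS(12) = 0.827`; D-0117: a structural LAW, not a range extension).  WHAT THIS IS NOT: no
window is certified or moved, nothing is a statement about `ζ`'s zeros, the residual `AllWindowsWitness` (stmt-19733)
stays RH-EQUIVALENT and unclaimed; nothing here bears on the truth of RH.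

For integer `θ = k + 1 ≥ 2`, `c_θ = (2π)^θ/k!` and `r_θ = 6θ(2πe/θ)^θ` (the constant of the small-`x` law
`SuzukiWindowsDoorArchLeadingTerm.abs_limKernel_sub_leading_le`: `|K_θ(u) − c_θu^ke^{−u/2}| ≤ r_θ u^θ e^{−u/2}`, `u ≤ 1/6`):

* §1 `integral_weight_mul_pow` (`∫₀^T (T−u)u^m du = T^{m+2}/((m+1)(m+2))`) and **`abs_sq_limKernel_sub_leading_le`**:
  `|K_θ(u)² − c_θ² u^{2k}| ≤ (c_θ + r_θ)² u^{2k+1}` for `0 ≤ u ≤ 1/6`;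
* §2 **`abs_weightedSq_limKernel_sub_leading_le`**: for `0 < t ≤ 1/12`,
  `|h_θ(t) − c_θ²(2t)^{2θ}/((2θ−1)2θ)| ≤ (c_θ + r_θ)²(2t)^{2θ+1}/(2θ(2θ+1))`, the same for the double integral
  `∫_{(−t,t)}∫_{(−t,t)} K_θ(x+y)² dy dx = ‖𝖪_θ[t]‖²_HS` (`abs_sq_integral_window_sub_leading_le`), and the limit
  **`tendsto_weightedSq_limKernel_div_pow`**: `h_θ(t)/(2t)^{2θ} → c_θ²/((2θ−1)2θ)` as `t → 0⁺` — the HS companion of the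
  operator-norm law `SuzukiWindowsDoorSmallWindowLaw` (`‖𝖪_θ[t]‖ ~ c_θ‖A_θ‖t^θ`; note `‖A_θ‖_HS = 2^θ/√((2θ−1)2θ)`, so
  the two laws say `‖𝖪_θ[t]‖/‖𝖪_θ[t]‖_HS → ‖A_θ‖/‖A_θ‖_HS ∈ [√((2θ−1)2θ)/(θ√(2θ+1)), 1]`).
  It sharpens eng-3 g4's envelope `h_θ(t) ≤ A_θ²(2t)^{2θ}/((2θ−1)2θ)` (`SuzukiWindowsDoorExplicitWindow.weightedSq_limKernel_le`,
  `A_θ/c_θ ≈ 1.8`) to an asymptotic equality with the sharp constant `c_θ²`.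

References: [Su20] M. Suzuki, ASPM 84 (2020) = arXiv:1907.07302, (1.4), §3; DATA.md §ET1, §ET1g, §ET1f-lite.
-/

noncomputable section

-- D-0017: `Summit.<S>.<S>.…` is the designed namespace of a single-problem summit.
set_option linter.dupNamespace false

open MeasureTheory Set Filter Topology

namespace Summit.RiemannHypothesis.RiemannHypothesis.Theorems.SuzukiWindowsDoorSmallWindowLawHS

open Literature.NumberTheory.LFunctions
open Summit.RiemannHypothesis.RiemannHypothesis.Theorems.SuzukiWindowsDoorArchLeadingTerm
open Summit.RiemannHypothesis.RiemannHypothesis.Theorems.SuzukiKernelSemigroup (limKernel_eq_zero_of_nonpos)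

/-! ## §1 A polynomial moment and the pointwise law for `K_θ²` -/

/-- `∫₀^T (T − u) u^m du = T^{m+2}/((m+1)(m+2))`. -/
theorem integral_weight_mul_pow (T : ℝ) (m : ℕ) :
    ∫ u in (0 : ℝ)..T, (T - u) * u ^ m = T ^ (m + 2) / (((m : ℝ) + 1) * ((m : ℝ) + 2)) := by
  have h : (fun u : ℝ => (T - u) * u ^ m) = fun u : ℝ => T * u ^ m - u ^ (m + 1) := by
    funext u; ring
  rw [h, intervalIntegral.integral_sub (Continuous.intervalIntegrable (by fun_prop) _ _)
      (Continuous.intervalIntegrable (by fun_prop) _ _), intervalIntegral.integral_const_mul,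
    integral_pow, integral_pow]
  simp only [ne_eq, Nat.succ_ne_zero, not_false_eq_true, zero_pow, sub_zero]
  push_cast
  have h1 : ((m : ℝ) + 1) ≠ 0 := by positivity
  have h2 : ((m : ℝ) + 1 + 1) ≠ 0 := by positivity
  field_simp
  ring

/-- RH-FREE · **pointwise law for `K_θ²`** (integer `θ = k+1 ≥ 2`): for `0 ≤ u ≤ 1/6`,
`|K_θ(u)² − c_θ² u^{2k}| ≤ (c_θ + r_θ)² u^{2k+1}`, `c_θ = (2π)^θ/k!`, `r_θ = 6θ(2πe/θ)^θ`
(`K_θ = c_θu^ke^{−u/2} + R`, `|R| ≤ r_θu^{k+1}`; `1 − e^{−u} ≤ u`, `u ≤ 1`). -/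
theorem abs_sq_limKernel_sub_leading_le {k : ℕ} (hk : 1 ≤ k) {u : ℝ} (hu0 : 0 ≤ u) (hu : u ≤ 1 / 6) :
    |limKernel ((k : ℝ) + 1) u ^ 2 - ((2 * Real.pi) ^ (k + 1) / (k.factorial : ℝ)) ^ 2 * u ^ (2 * k)| ≤
      ((2 * Real.pi) ^ (k + 1) / (k.factorial : ℝ) +
          6 * ((k : ℝ) + 1) * (2 * Real.pi * Real.exp 1 / ((k : ℝ) + 1)) ^ (k + 1)) ^ 2 * u ^ (2 * k + 1) := by
  have hk0 : (0 : ℝ) ≤ k := Nat.cast_nonneg k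
  have hθ : (1 : ℝ) < (k : ℝ) + 1 := by linarith [show (1 : ℝ) ≤ k from by exact_mod_cast hk]
  set c : ℝ := (2 * Real.pi) ^ (k + 1) / (k.factorial : ℝ) with hcdef
  set r : ℝ := 6 * ((k : ℝ) + 1) * (2 * Real.pi * Real.exp 1 / ((k : ℝ) + 1)) ^ (k + 1) with hrdef
  have hc0 : 0 ≤ c := by positivity
  have hr0 : 0 ≤ r := by positivity
  rcases eq_or_lt_of_le hu0 with h0 | hu0'
  · -- `u = 0`: both sides vanish
    rw [← h0, limKernel_eq_zero_of_nonpos hθ le_rfl, zero_pow two_ne_zero, zero_pow (by omega),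
      zero_pow (by omega), mul_zero, sub_zero, abs_zero, mul_zero]
  · set L : ℝ := c * u ^ k * Real.exp (-(u / 2)) with hLdef
    set R : ℝ := limKernel ((k : ℝ) + 1) u - L with hRdef
    have hKLR : limKernel ((k : ℝ) + 1) u = L + R := by rw [hRdef]; ring
    have hexp1 : Real.exp (-(u / 2)) ≤ 1 := Real.exp_le_one_iff.mpr (by linarith)
    have hexp0 : 0 < Real.exp (-(u / 2)) := Real.exp_pos _
    -- the remainder bound `|R| ≤ r u^{k+1}`
    have hR : |R| ≤ r * u ^ (k + 1) := by
      have h := abs_limKernel_sub_leading_le hk hu0' hu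
      have hLeq : (2 * Real.pi) ^ (k + 1) * (u ^ k * Real.exp (-(u / 2)) / (k.factorial : ℝ)) = L := by
        rw [hLdef, hcdef]; ring
      rw [hLeq] at h
      refine h.trans ?_
      have hu1 : u ^ (k + 1) * Real.exp (-(u / 2)) ≤ u ^ (k + 1) := by
        have := mul_le_mul_of_nonneg_left hexp1 (pow_nonneg hu0 (k + 1))
        rwa [mul_one] at this
      have hsplit : (2 * Real.pi * Real.exp 1 * u / ((k : ℝ) + 1)) ^ (k + 1) =
          (2 * Real.pi * Real.exp 1 / ((k : ℝ) + 1)) ^ (k + 1) * u ^ (k + 1) := by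
        rw [← mul_pow]; congr 1; ring
      calc 6 * ((k : ℝ) + 1) * (2 * Real.pi * Real.exp 1 * u / ((k : ℝ) + 1)) ^ (k + 1) * Real.exp (-(u / 2))
          = r * (u ^ (k + 1) * Real.exp (-(u / 2))) := by rw [hsplit, hrdef]; ring
        _ ≤ r * u ^ (k + 1) := mul_le_mul_of_nonneg_left hu1 hr0
    have hLabs : |L| ≤ c * u ^ k := by
      rw [hLdef, abs_of_nonneg (by positivity)]
      have := mul_le_mul_of_nonneg_left hexp1 (by positivity : 0 ≤ c * u ^ k)
      rwa [mul_one] at this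
    -- the three pieces
    have hL2 : L ^ 2 = c ^ 2 * u ^ (2 * k) * Real.exp (-u) := by
      rw [hLdef, mul_pow, mul_pow, ← Real.exp_nat_mul, ← pow_mul, show k * 2 = 2 * k by ring]
      congr 1
      push_cast
      ring_nf
    have hP1 : |L ^ 2 - c ^ 2 * u ^ (2 * k)| ≤ c ^ 2 * u ^ (2 * k + 1) := by
      rw [hL2, show c ^ 2 * u ^ (2 * k) * Real.exp (-u) - c ^ 2 * u ^ (2 * k) =
        -(c ^ 2 * u ^ (2 * k) * (1 - Real.exp (-u))) by ring, abs_neg,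
        abs_of_nonneg (by
          have : Real.exp (-u) ≤ 1 := Real.exp_le_one_iff.mpr (by linarith)
          have : 0 ≤ 1 - Real.exp (-u) := by linarith
          positivity)]
      have h1e : 1 - Real.exp (-u) ≤ u := by linarith [Real.add_one_le_exp (-u)]
      calc c ^ 2 * u ^ (2 * k) * (1 - Real.exp (-u)) ≤ c ^ 2 * u ^ (2 * k) * u :=
            mul_le_mul_of_nonneg_left h1e (by positivity)
        _ = c ^ 2 * u ^ (2 * k + 1) := by rw [pow_succ]; ring
    have hP2 : |2 * L * R| ≤ 2 * c * r * u ^ (2 * k + 1) := by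
      rw [abs_mul, abs_mul, abs_two]
      calc 2 * |L| * |R| ≤ 2 * (c * u ^ k) * (r * u ^ (k + 1)) := by gcongr
        _ = 2 * c * r * u ^ (2 * k + 1) := by ring
    have hP3 : |R ^ 2| ≤ r ^ 2 * u ^ (2 * k + 1) := by
      rw [abs_pow]
      have hu1 : u ≤ 1 := by linarith
      calc |R| ^ 2 ≤ (r * u ^ (k + 1)) ^ 2 := pow_le_pow_left₀ (abs_nonneg _) hR 2
        _ = r ^ 2 * u ^ (2 * k + 1) * u := by ring
        _ ≤ r ^ 2 * u ^ (2 * k + 1) * 1 := mul_le_mul_of_nonneg_left hu1 (by positivity)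
        _ = r ^ 2 * u ^ (2 * k + 1) := mul_one _
    rw [hKLR, show (L + R) ^ 2 - c ^ 2 * u ^ (2 * k) = (L ^ 2 - c ^ 2 * u ^ (2 * k)) + 2 * L * R + R ^ 2 by ring]
    calc |L ^ 2 - c ^ 2 * u ^ (2 * k) + 2 * L * R + R ^ 2|
        ≤ |L ^ 2 - c ^ 2 * u ^ (2 * k) + 2 * L * R| + |R ^ 2| := abs_add_le _ _
      _ ≤ |L ^ 2 - c ^ 2 * u ^ (2 * k)| + |2 * L * R| + |R ^ 2| := by gcongr; exact abs_add_le _ _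
      _ ≤ c ^ 2 * u ^ (2 * k + 1) + 2 * c * r * u ^ (2 * k + 1) + r ^ 2 * u ^ (2 * k + 1) :=
          add_le_add (add_le_add hP1 hP2) hP3
      _ = (c + r) ^ 2 * u ^ (2 * k + 1) := by ring

/-! ## §2 The Hilbert–Schmidt small-window law -/

/-- RH-FREE · **THE HILBERT–SCHMIDT SMALL-WINDOW LAW**: for integer `θ = k+1 ≥ 2` and `0 < t ≤ 1/12`,
`|∫₀^{2t}(2t−u)K_θ(u)²du − c_θ²(2t)^{2k+2}/((2k+1)(2k+2))| ≤ (c_θ + r_θ)²(2t)^{2k+3}/((2k+2)(2k+3))`.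
(`h_θ(t) = ‖𝖪_θ[t]‖²_HS`; DATA §ET1's `t_HS` is where `h_θ = 1`.)  Nothing here bears on RH. -/
theorem abs_weightedSq_limKernel_sub_leading_le {k : ℕ} (hk : 1 ≤ k) {t : ℝ} (ht0 : 0 < t) (ht : t ≤ 1 / 12) :
    |(∫ u in (0 : ℝ)..(2 * t), (2 * t - u) * limKernel ((k : ℝ) + 1) u ^ 2) -
        ((2 * Real.pi) ^ (k + 1) / (k.factorial : ℝ)) ^ 2 * (2 * t) ^ (2 * k + 2) /
          ((2 * (k : ℝ) + 1) * (2 * (k : ℝ) + 2))| ≤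
      ((2 * Real.pi) ^ (k + 1) / (k.factorial : ℝ) +
          6 * ((k : ℝ) + 1) * (2 * Real.pi * Real.exp 1 / ((k : ℝ) + 1)) ^ (k + 1)) ^ 2 *
        (2 * t) ^ (2 * k + 3) / ((2 * (k : ℝ) + 2) * (2 * (k : ℝ) + 3)) := by
  have hk0 : (0 : ℝ) ≤ k := Nat.cast_nonneg k
  have hθ : (1 : ℝ) < (k : ℝ) + 1 := by linarith [show (1 : ℝ) ≤ k from by exact_mod_cast hk]
  set c : ℝ := (2 * Real.pi) ^ (k + 1) / (k.factorial : ℝ) with hcdef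
  set r : ℝ := 6 * ((k : ℝ) + 1) * (2 * Real.pi * Real.exp 1 / ((k : ℝ) + 1)) ^ (k + 1) with hrdef
  set T : ℝ := 2 * t with hT
  have hT0 : 0 ≤ T := by rw [hT]; linarith
  have hKc : Continuous (limKernel ((k : ℝ) + 1)) := Suzuki2020_thm12_continuous hθ
  -- the leading term as a moment integral
  have hlead : c ^ 2 * T ^ (2 * k + 2) / ((2 * (k : ℝ) + 1) * (2 * (k : ℝ) + 2)) =
      ∫ u in (0 : ℝ)..T, (T - u) * (c ^ 2 * u ^ (2 * k)) := by
    have h := integral_weight_mul_pow T (2 * k)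
    have hf : (fun u : ℝ => (T - u) * (c ^ 2 * u ^ (2 * k))) = fun u : ℝ => c ^ 2 * ((T - u) * u ^ (2 * k)) := by
      funext u; ring
    rw [hf, intervalIntegral.integral_const_mul, h]
    push_cast
    ring
  have herr : (c + r) ^ 2 * T ^ (2 * k + 3) / ((2 * (k : ℝ) + 2) * (2 * (k : ℝ) + 3)) =
      ∫ u in (0 : ℝ)..T, (T - u) * ((c + r) ^ 2 * u ^ (2 * k + 1)) := by
    have h := integral_weight_mul_pow T (2 * k + 1)
    have hf : (fun u : ℝ => (T - u) * ((c + r) ^ 2 * u ^ (2 * k + 1))) =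
        fun u : ℝ => (c + r) ^ 2 * ((T - u) * u ^ (2 * k + 1)) := by
      funext u; ring
    rw [hf, intervalIntegral.integral_const_mul, h, show 2 * k + 1 + 2 = 2 * k + 3 by ring]
    push_cast
    ring
  have hi1 : IntervalIntegrable (fun u : ℝ => (T - u) * limKernel ((k : ℝ) + 1) u ^ 2) volume 0 T :=
    ((continuous_const.sub continuous_id).mul (hKc.pow 2)).intervalIntegrable _ _
  have hi2 : IntervalIntegrable (fun u : ℝ => (T - u) * (c ^ 2 * u ^ (2 * k))) volume 0 T :=
    Continuous.intervalIntegrable (by fun_prop) _ _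
  rw [hlead, herr, ← intervalIntegral.integral_sub hi1 hi2]
  refine (intervalIntegral.abs_integral_le_integral_abs hT0).trans ?_
  refine intervalIntegral.integral_mono_on hT0 ((hi1.sub hi2).abs) (Continuous.intervalIntegrable (by fun_prop) _ _)
    fun u hu => ?_
  have hu0 : 0 ≤ u := hu.1
  have hu6 : u ≤ 1 / 6 := by have := hu.2; rw [hT] at this; linarith
  have hw : 0 ≤ T - u := by linarith [hu.2]
  rw [← mul_sub, abs_mul, abs_of_nonneg hw]
  exact mul_le_mul_of_nonneg_left (abs_sq_limKernel_sub_leading_le hk hu0 hu6) hw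

/-- RH-FREE · the same law for the Hilbert–Schmidt double integral `∫_{(−t,t)}∫_{(−t,t)} K_θ(x+y)² dy dx = ‖𝖪_θ[t]‖²_HS`
(`SuzukiHSWindow.sq_integral_window_eq_weighted`). -/
theorem abs_sq_integral_window_sub_leading_le {k : ℕ} (hk : 1 ≤ k) {t : ℝ} (ht0 : 0 < t) (ht : t ≤ 1 / 12) :
    |(∫ x in Ioo (-t) t, ∫ y in Ioo (-t) t, limKernel ((k : ℝ) + 1) (x + y) ^ 2) -
        ((2 * Real.pi) ^ (k + 1) / (k.factorial : ℝ)) ^ 2 * (2 * t) ^ (2 * k + 2) /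
          ((2 * (k : ℝ) + 1) * (2 * (k : ℝ) + 2))| ≤
      ((2 * Real.pi) ^ (k + 1) / (k.factorial : ℝ) +
          6 * ((k : ℝ) + 1) * (2 * Real.pi * Real.exp 1 / ((k : ℝ) + 1)) ^ (k + 1)) ^ 2 *
        (2 * t) ^ (2 * k + 3) / ((2 * (k : ℝ) + 2) * (2 * (k : ℝ) + 3)) := by
  have hk0 : (0 : ℝ) ≤ k := Nat.cast_nonneg k
  have hθ : (1 : ℝ) < (k : ℝ) + 1 := by linarith [show (1 : ℝ) ≤ k from by exact_mod_cast hk]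
  rw [SuzukiHSWindow.sq_integral_window_eq_weighted (Suzuki2020_thm12_continuous hθ)
    (fun u hu => Suzuki2020_thm12_Kiii hθ hu) ht0]
  exact abs_weightedSq_limKernel_sub_leading_le hk ht0 ht

/-- RH-FREE · **limit form**: `h_θ(t)/(2t)^{2θ} → c_θ²/((2θ−1)2θ)` as `t → 0⁺` (integer `θ = k+1 ≥ 2`). -/
theorem tendsto_weightedSq_limKernel_div_pow {k : ℕ} (hk : 1 ≤ k) :
    Tendsto (fun t : ℝ => (∫ u in (0 : ℝ)..(2 * t), (2 * t - u) * limKernel ((k : ℝ) + 1) u ^ 2) /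
        (2 * t) ^ (2 * k + 2)) (𝓝[>] 0)
      (𝓝 (((2 * Real.pi) ^ (k + 1) / (k.factorial : ℝ)) ^ 2 / ((2 * (k : ℝ) + 1) * (2 * (k : ℝ) + 2)))) := by
  have hk0 : (0 : ℝ) ≤ k := Nat.cast_nonneg k
  set c : ℝ := (2 * Real.pi) ^ (k + 1) / (k.factorial : ℝ) with hcdef
  set r : ℝ := 6 * ((k : ℝ) + 1) * (2 * Real.pi * Real.exp 1 / ((k : ℝ) + 1)) ^ (k + 1) with hrdef
  set M : ℝ := (c + r) ^ 2 / ((2 * (k : ℝ) + 2) * (2 * (k : ℝ) + 3)) with hMdef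
  have key : ∀ᶠ t in 𝓝[>] (0 : ℝ),
      ‖(∫ u in (0 : ℝ)..(2 * t), (2 * t - u) * limKernel ((k : ℝ) + 1) u ^ 2) / (2 * t) ^ (2 * k + 2) -
          c ^ 2 / ((2 * (k : ℝ) + 1) * (2 * (k : ℝ) + 2))‖ ≤ M * (2 * t) := by
    filter_upwards [Ioo_mem_nhdsGT (show (0 : ℝ) < 1 / 12 by norm_num)] with t ht
    have ht0 : 0 < t := ht.1
    have hT : 0 < (2 * t) ^ (2 * k + 2) := by positivity
    have h := abs_weightedSq_limKernel_sub_leading_le hk ht0 ht.2.le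
    rw [Real.norm_eq_abs,
      show (∫ u in (0 : ℝ)..(2 * t), (2 * t - u) * limKernel ((k : ℝ) + 1) u ^ 2) / (2 * t) ^ (2 * k + 2) -
          c ^ 2 / ((2 * (k : ℝ) + 1) * (2 * (k : ℝ) + 2)) =
        ((∫ u in (0 : ℝ)..(2 * t), (2 * t - u) * limKernel ((k : ℝ) + 1) u ^ 2) -
          c ^ 2 * (2 * t) ^ (2 * k + 2) / ((2 * (k : ℝ) + 1) * (2 * (k : ℝ) + 2))) / (2 * t) ^ (2 * k + 2) by
        field_simp,
      abs_div, abs_of_pos hT, div_le_iff₀ hT]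
    refine h.trans (le_of_eq ?_)
    rw [hMdef, pow_succ (2 * t) (2 * k + 2)]
    ring
  have hlim : Tendsto (fun t : ℝ => M * (2 * t)) (𝓝[>] 0) (𝓝 0) := by
    have h : Tendsto (fun t : ℝ => M * (2 * t)) (𝓝 0) (𝓝 (M * (2 * 0))) :=
      (continuous_const.mul (continuous_const.mul continuous_id)).tendsto 0
    rw [mul_zero, mul_zero] at h
    exact h.mono_left nhdsWithin_le_nhds
  exact tendsto_sub_nhds_zero_iff.1 (squeeze_zero_norm' key hlim)

end Summit.RiemannHypothesis.RiemannHypothesis.Theorems.SuzukiWindowsDoorSmallWindowLawHS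

end
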